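import Literature.Analysis.FunctionSpaces.SpaceTimeWeakCompactness
import Literature.Analysis.FunctionSpaces.RieszRepresentationTestFields
import HarnessLib

/-!
# Weak sequential compactness of bounded sequences in `L³`, tested on smooth compactly
supported fields

Analysis/FunctionSpaces support file (theorems only, [folklore]). The "`u₀^k ⇀ u₀` in `L³`,
`‖u₀‖_{L³} ≤ liminf ‖u₀^k‖_{L³}`" step of every weak-stability argument with `L³`-bounded data
(Jia–Šverák 2013, proof of Thm. 1; Seregin 2012, §3: "`a₀` is the weak `L₃(ℝ³)`-limit of the
sequence `u^{(k)}(·, −S)`"; Lemarié-Rieusset 2016, p. 571) is the reflexivity of `L³`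
(Brezis 2011, Thm. 3.18 with Thm. 4.10). Mathlib (this pin) has no sequential Banach–Alaoglu
and no `L^p`–`L^q` duality for `p ≠ 2`; the tree has the Hilbert-space statement
`exists_strictMono_tendsto_inner_of_norm_le` (`SpaceTimeWeakCompactness.lean`), "`L³` by
duality against test fields" `memLp_three_of_forall_abs_integral_inner_le`
(`TestPairingLimits.lean`), and the weight bookkeeping of `RieszRepresentationTestFields.lean`
(whose Riesz theorem `L³ = (L^{3/2})*` on test fields uses the same weighted reduction). This
file combines them:

* `exists_strictMono_tendsto_integral_inner_of_eLpNorm_three_le` — for vector fields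
  `a k : E → E` on a finite-dimensional inner product space with `‖a k‖_{L³} ≤ M` there are a
  subsequence `σ` and `a' ∈ L³` with `‖a'‖_{L³} ≤ M` such that `∫ ⟪a (σ k), φ⟫ → ∫ ⟪a', φ⟫` for
  every smooth compactly supported field `φ`.

Proof (a weighted reduction to `L²`, avoiding any gluing of local limits): with the polynomial
weight `ρ(x) = ((1 + ‖x‖²)^m)⁻¹ ∈ L⁶` (`m = dim E + 1`), the fields `ρ a k` are bounded in the
separable Hilbert space `L²(E; E)` (Hölder `‖ρ a‖₂ ≤ ‖ρ‖₆ ‖a‖₃`), so along a subsequence they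
converge weakly to some `w ∈ L²`; put `a' = ρ⁻¹ w ∈ L²_loc`. Since `ρ⁻¹ φ` is again a test field,
`∫ ⟪a (σ k), φ⟫ = ⟪ρ a (σ k), ρ⁻¹ φ⟫_{L²} → ⟪w, ρ⁻¹ φ⟫_{L²} = ∫ ⟪a', φ⟫`, and
`|∫ ⟪a', φ⟫| ≤ M ‖φ‖_{3/2}` (Hölder along the sequence) puts `a'` in `L³` with `‖a'‖₃ ≤ M`.

## References

* H. Brezis, *Functional Analysis, Sobolev Spaces and PDE* (2011), Thm. 3.18, Thm. 4.10.
* H. Jia, V. Šverák, SIAM J. Math. Anal. 45 (2013) = arXiv:1201.1592, proof of Thm. 1.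
-/

noncomputable section

open MeasureTheory Filter Set Function TopologicalSpace Metric
open _root_.Topology
open scoped ENNReal NNReal InnerProductSpace RealInnerProductSpace

namespace Literature.Analysis.FunctionSpaces

/-! ### A Hölder triple -/

/-- `1/6 + 1/3 = 1/2`. [folklore] -/
theorem holderTriple_six_three_two : ENNReal.HolderTriple 6 3 2 := by
  refine ⟨?_⟩
  have e6 : (6 : ℝ≥0∞) = ENNReal.ofReal 6 := by simp
  have e3 : (3 : ℝ≥0∞) = ENNReal.ofReal 3 := by simp
  have e2 : (2 : ℝ≥0∞) = ENNReal.ofReal 2 := by simp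
  rw [e6, e3, e2, ← ENNReal.ofReal_inv_of_pos (by norm_num), ← ENNReal.ofReal_inv_of_pos (by norm_num),
    ← ENNReal.ofReal_inv_of_pos (by norm_num), ← ENNReal.ofReal_add (by norm_num) (by norm_num)]
  norm_num

section Pairing

variable {E : Type*} [NormedAddCommGroup E] [InnerProductSpace ℝ E] [FiniteDimensional ℝ E]
  [MeasurableSpace E] [BorelSpace E]

/-- **Hölder with exponents `(3, 3/2)` for the pairing of vector fields**:
`|∫ ⟪f, φ⟫| ≤ ‖f‖_{L³} ‖φ‖_{L^{3/2}}`. [folklore] -/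
theorem abs_integral_inner_le_eLpNorm_three_mul_threeHalves {f φ : E → E} (hf : MemLp f 3 volume)
    (hφ : MemLp φ (3 / 2 : ℝ≥0∞) volume) :
    |∫ x, ⟪f x, φ x⟫| ≤ (eLpNorm f 3 volume).toReal * (eLpNorm φ (3 / 2 : ℝ≥0∞) volume).toReal := by
  haveI : ENNReal.HolderTriple 3 (3 / 2) 1 := by
    refine ⟨?_⟩
    have e1 : (3 / 2 : ℝ≥0∞) = ENNReal.ofReal (3 / 2) := by
      rw [ENNReal.ofReal_div_of_pos (by norm_num)]; simp
    have e2 : (3 : ℝ≥0∞) = ENNReal.ofReal 3 := by simp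
    rw [inv_one, e1, e2, ← ENNReal.ofReal_inv_of_pos (by norm_num),
      ← ENNReal.ofReal_inv_of_pos (by norm_num), ← ENNReal.ofReal_add (by norm_num) (by norm_num),
      ← ENNReal.ofReal_one]
    norm_num
  have h1 : ‖∫ x, ⟪f x, φ x⟫‖ₑ ≤ eLpNorm (fun x => ⟪f x, φ x⟫) 1 volume := by
    rw [eLpNorm_one_eq_lintegral_enorm]
    exact enorm_integral_le_lintegral_enorm _
  have h2 : eLpNorm (fun x => ⟪f x, φ x⟫) 1 volume ≤ eLpNorm f 3 volume * eLpNorm φ (3 / 2) volume := by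
    have h := eLpNorm_le_eLpNorm_mul_eLpNorm'_of_norm hf.1 hφ.1 (fun v w => ⟪v, w⟫) 1
      (Eventually.of_forall fun x => by
        rw [NNReal.coe_one, one_mul]; exact norm_inner_le_norm (f x) (φ x)) (hpqr := this)
    simpa using h
  have hfin : eLpNorm f 3 volume * eLpNorm φ (3 / 2) volume ≠ ∞ :=
    ENNReal.mul_ne_top hf.eLpNorm_ne_top hφ.eLpNorm_ne_top
  have h3 := h1.trans h2
  rw [Real.enorm_eq_ofReal_abs, ENNReal.ofReal_le_iff_le_toReal hfin, ENNReal.toReal_mul] at h3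
  exact h3

/-! ### Weak compactness in `L³` -/

/-- **Weak sequential compactness of bounded sequences in `L³`, tested on smooth compactly
supported fields** (Brezis 2011, Thm. 3.18 with the reflexivity of `L³`, Thm. 4.10; the step
"`u₀^k ⇀ u₀` in `L³`, `‖u₀‖_{L³} ≤ liminf ‖u₀^k‖_{L³}`" of Jia–Šverák 2013, proof of Thm. 1).
If `a k ∈ L³(E; E)` with `‖a k‖_{L³} ≤ M`, then there are a strictly increasing `σ : ℕ → ℕ` and
`a' ∈ L³` with `‖a'‖_{L³} ≤ M` such that `∫ ⟪a (σ k), φ⟫ → ∫ ⟪a', φ⟫` for every smooth compactly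
supported `φ : E → E`. Proof: module docstring (weighted reduction to weak compactness in the
Hilbert space `L²`, then `L³` by duality). [cite: Brezis2011, Thm. 3.18 and Thm. 4.10] -/
theorem exists_strictMono_tendsto_integral_inner_of_eLpNorm_three_le {a : ℕ → E → E} {M : ℝ≥0}
    (ha : ∀ k, MemLp (a k) 3 volume) (hM : ∀ k, eLpNorm (a k) 3 volume ≤ M) :
    ∃ σ : ℕ → ℕ, StrictMono σ ∧ ∃ a' : E → E, MemLp a' 3 volume ∧ eLpNorm a' 3 volume ≤ M ∧
      ∀ φ : E → E, IsTestFunctionOn (⊤ : Opens E) φ →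
        Tendsto (fun k => ∫ x, ⟪a (σ k) x, φ x⟫) atTop (𝓝 (∫ x, ⟪a' x, φ x⟫)) := by
  haveI : Fact ((2 : ℝ≥0∞) ≠ ∞) := ⟨ENNReal.ofNat_ne_top⟩
  haveI : SeparableSpace (Lp E 2 (volume : Measure E)) := inferInstance
  haveI hHT : ENNReal.HolderTriple 6 3 2 := holderTriple_six_three_two
  set m : ℕ := Module.finrank ℝ E + 1 with hm
  set ρ : E → ℝ := fun x => ((1 + ‖x‖ ^ 2) ^ m)⁻¹ with hρ
  have hρ6 : MemLp ρ 6 volume := memLp_six_inv_one_add_norm_sq_pow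
  have hρc : Continuous ρ := (contDiff_inv_one_add_norm_sq_pow m).continuous
  have hρpos : ∀ x, 0 < ρ x := fun x => by positivity
  have hρic : Continuous fun x => (ρ x)⁻¹ := hρc.inv₀ fun x => (hρpos x).ne'
  -- Hölder: `ρ a k ∈ L²` with `‖ρ a k‖₂ ≤ ‖ρ‖₆ M`
  have hb : ∀ k, MemLp (fun x => ρ x • a k x) 2 volume := fun k => (ha k).smul hρ6
  have hbnorm : ∀ k, eLpNorm (fun x => ρ x • a k x) 2 volume ≤ eLpNorm ρ 6 volume * M := by
    intro k
    have h := eLpNorm_smul_le_mul_eLpNorm (p := 6) (q := 3) (r := 2) (ha k).1 hρ6.1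
    exact h.trans (mul_le_mul_right (hM k) _)
  set R : ℝ := (eLpNorm ρ 6 volume * M).toReal with hR
  have hRfin : eLpNorm ρ 6 volume * M ≠ ∞ := ENNReal.mul_ne_top hρ6.eLpNorm_ne_top ENNReal.coe_ne_top
  set v : ℕ → Lp E 2 (volume : Measure E) := fun k => (hb k).toLp _ with hv
  have hvn : ∀ k, ‖v k‖ ≤ R := fun k => by
    rw [hv, Lp.norm_toLp, hR]
    exact ENNReal.toReal_mono hRfin (hbnorm k)
  -- weak compactness in the Hilbert space `L²`
  obtain ⟨σ, hσ, w, -, hw⟩ := exists_strictMono_tendsto_inner_of_norm_le hvn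
  -- the limit field `a' = ρ⁻¹ w`
  set a' : E → E := fun x => (ρ x)⁻¹ • (w : E → E) x with ha'
  have hwm : AEStronglyMeasurable (w : E → E) volume := Lp.aestronglyMeasurable w
  have hw2 : MemLp (w : E → E) 2 volume := Lp.memLp w
  have ha'm : AEStronglyMeasurable a' volume := hρic.aestronglyMeasurable.smul hwm
  have ha'2 : LocallyIntegrable (fun x => ‖a' x‖ ^ 2) volume := by
    have hint : Integrable (fun x => ‖(w : E → E) x‖ ^ 2) volume :=
      (memLp_two_iff_integrable_sq_norm hwm).1 hw2
    have hcont : Continuous fun x => ((ρ x)⁻¹) ^ 2 := hρic.pow 2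
    have h1 : LocallyIntegrableOn (fun x => ((ρ x)⁻¹) ^ 2 * ‖(w : E → E) x‖ ^ 2) univ volume :=
      (hint.locallyIntegrable.locallyIntegrableOn univ).continuousOn_mul hcont.continuousOn
        isClosed_univ.isLocallyClosed
    have heq : (fun x => ‖a' x‖ ^ 2) = fun x => ((ρ x)⁻¹) ^ 2 * ‖(w : E → E) x‖ ^ 2 := by
      funext x
      rw [ha']
      simp only [norm_smul, Real.norm_eq_abs, abs_of_pos (inv_pos.2 (hρpos x)), mul_pow]
    rw [heq]
    exact locallyIntegrableOn_univ.1 h1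
  -- the pairings converge
  have hpair : ∀ φ : E → E, IsTestFunctionOn (⊤ : Opens E) φ →
      Tendsto (fun k => ∫ x, ⟪a (σ k) x, φ x⟫) atTop (𝓝 (∫ x, ⟪a' x, φ x⟫)) := by
    intro φ hφ
    have hψ : IsTestFunctionOn (⊤ : Opens E) (fun x => (1 + ‖x‖ ^ 2) ^ m • φ x) :=
      isTestFunctionOn_smul_left_of_contDiff hφ (contDiff_one_add_norm_sq_pow m)
    have hψ2 : MemLp (fun x => (1 + ‖x‖ ^ 2) ^ m • φ x) 2 volume :=
      hψ.contDiff.continuous.memLp_of_hasCompactSupport hψ.hasCompactSupport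
    have h1 : ∀ k, ⟪v k, hψ2.toLp _⟫ = ∫ x, ⟪a k x, φ x⟫ := by
      intro k
      rw [hv, L2.inner_def]
      refine integral_congr_ae ?_
      filter_upwards [(hb k).coeFn_toLp, hψ2.coeFn_toLp] with x hx hy
      rw [hx, hy]
      show ⟪ρ x • a k x, (1 + ‖x‖ ^ 2) ^ m • φ x⟫ = ⟪a k x, φ x⟫
      have hne : (1 + ‖x‖ ^ 2) ^ m ≠ 0 := by positivity
      rw [real_inner_smul_left, real_inner_smul_right, ← mul_assoc, hρ]
      dsimp only
      rw [inv_mul_cancel₀ hne, one_mul]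
    have h2 : ⟪w, hψ2.toLp _⟫ = ∫ x, ⟪a' x, φ x⟫ := by
      rw [L2.inner_def]
      refine integral_congr_ae ?_
      filter_upwards [hψ2.coeFn_toLp] with x hy
      rw [hy]
      show ⟪(w : E → E) x, (1 + ‖x‖ ^ 2) ^ m • φ x⟫ = ⟪(ρ x)⁻¹ • (w : E → E) x, φ x⟫
      rw [real_inner_smul_left, real_inner_smul_right, hρ, inv_inv]
    have h3 := hw (hψ2.toLp _)
    rw [h2] at h3
    refine h3.congr fun k => ?_
    exact h1 (σ k)
  -- `L³` by duality
  have hbound : ∀ φ : E → E, IsTestFunctionOn (⊤ : Opens E) φ →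
      |∫ x, ⟪a' x, φ x⟫| ≤ (M : ℝ) * (eLpNorm φ (3 / 2 : ℝ≥0∞) volume).toReal := by
    intro φ hφ
    have hφq : MemLp φ (3 / 2 : ℝ≥0∞) volume :=
      hφ.contDiff.continuous.memLp_of_hasCompactSupport hφ.hasCompactSupport
    refine le_of_tendsto ((continuous_abs.tendsto _).comp (hpair φ hφ))
      (Eventually.of_forall fun k => ?_)
    refine (abs_integral_inner_le_eLpNorm_three_mul_threeHalves (ha (σ k)) hφq).trans ?_
    refine mul_le_mul_of_nonneg_right ?_ ENNReal.toReal_nonneg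
    have h := ENNReal.toReal_mono ENNReal.coe_ne_top (hM (σ k))
    rwa [ENNReal.coe_toReal] at h
  obtain ⟨h3, hle⟩ := memLp_three_of_forall_abs_integral_inner_le ha'm ha'2 M.coe_nonneg hbound
  refine ⟨σ, hσ, a', h3, ?_, hpair⟩
  rwa [ENNReal.ofReal_coe_nnreal] at hle

end Pairing

end Literature.Analysis.FunctionSpaces

end
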